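import Mathlib.Analysis.Calculus.DifferentialForm.Basic
import Mathlib.Analysis.Calculus.FDeriv.Mul
import Mathlib.Analysis.Calculus.FDeriv.RestrictScalars
import Mathlib.Analysis.Calculus.ContDiff.Basic
import Mathlib.Analysis.Complex.Basic
import HarnessLib

/-!
# The operators `d^c` and `dd^c` on real functions of a complex normed space

For a real function `f` on a complex normed space `V` (viewed as a real normed space), the real
`1`-form field **`d^c f = -df ∘ J`**, `J v = i v` — in the normalisation `d^c = i(∂̄ - ∂)`, so that
`dd^c = 2i ∂∂̄` and `dd^c |z|² = 4 Σ dx_j ∧ dy_j` [Demailly, *Complex analytic and differential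
geometry*, Ch. I (1.13)–(3.?)], [Chirka1989, §13.2] — and the real `2`-form field
**`dd^c f = d(d^c f)`** (Mathlib's `extDeriv`). Main formulas:

* `dcForm_apply` — `(d^c f)(x)(v) = -Df(x)(i v)`;
* `ddcForm_apply` — `(dd^c f)(x)(a, b) = D²f(x)(b)(i a) - D²f(x)(a)(i b)` when `Df` is
  differentiable at `x`;
* `ddcForm_apply_self_I_smul` — **`(dd^c f)(x)(a, i a) = D²f(x)(a)(a) + D²f(x)(i a)(i a)`**, the
  Levi form of `f` (nonnegative in every direction iff `f` is plurisubharmonic, for `C²` functions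
  [HormanderSCV1973, Thm. 2.6.2]);
* `extDeriv_ddcForm` — `d(dd^c f) = 0` for `C³` functions (`d ∘ d = 0`).

Definitions with bodies (`dcForm`, `ddcForm`); everything else proved from Mathlib.

## References

* E. M. Chirka, *Complex Analytic Sets*, Kluwer 1989, §13.2 (`d^c`, `dd^c`, `ω = ¼ dd^c |z|²`)
  [Chirka1989].
* J.-P. Demailly, *Complex analytic and differential geometry*, Ch. I §1, Ch. III §1 (`d^c`).
* L. Hörmander, *An introduction to complex analysis in several variables*, Thm. 2.6.2
  [HormanderSCV1973].
-/

open scoped Topology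
open Set Filter

noncomputable section

namespace Literature.Geometry.Kaehler

variable {V : Type*} [NormedAddCommGroup V] [NormedSpace ℂ V]

/-! ### The complex structure `J v = i v` as a real continuous linear map (private helper) -/

variable (V) in
/-- The complex structure `J : v ↦ i v` of a complex normed space, as a REAL continuous linear map
(the same map as `Literature.Geometry.Kaehler.mulI` of `DolbeaultSymbolWedge.lean`, which is not
imported here to keep this file Mathlib-only; private helper). [folklore] -/
private def iSMulCLM : V →L[ℝ] V := ((Complex.I • ContinuousLinearMap.id ℂ V)).restrictScalars ℝ

/-- `J v = i v`. [folklore] -/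
@[simp] private theorem iSMulCLM_apply (v : V) : iSMulCLM V v = Complex.I • v := rfl

/-! ### `d^c f` -/

/-- **The real `1`-form `d^c f = -df ∘ J`** of a real function `f` on a complex normed space:
`(d^c f)(x)(v) = -Df(x)(i v)` (`= i(∂̄ - ∂) f`; with this normalisation `dd^c |z|² = 4 Σ dx_j ∧ dy_j`
and `¼ dd^c |z|²` is the Euclidean Kähler form). Built with the real Fréchet derivative
`fderiv ℝ f x` (junk value `0` where `f` is not differentiable). [cite: Chirka1989, §13.2] -/
def dcForm (f : V → ℝ) (x : V) : V [⋀^Fin 1]→L[ℝ] ℝ :=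
  ContinuousAlternatingMap.ofSubsingleton ℝ V ℝ (0 : Fin 1) (-((fderiv ℝ f x).comp (iSMulCLM V)))

/-- `(d^c f)(x)(v) = -Df(x)(i v₀)`. [cite: Chirka1989, §13.2] -/
@[simp] theorem dcForm_apply (f : V → ℝ) (x : V) (v : Fin 1 → V) :
    dcForm f x v = -(fderiv ℝ f x (Complex.I • v 0)) := by
  simp [dcForm]

/-- `d^c f` as the composite of the linear isometry `ofSubsingleton` with `x ↦ -(Df(x) ∘ J)`.
[folklore] -/
private theorem dcForm_eq_comp (f : V → ℝ) :
    dcForm f = fun x =>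
      ContinuousAlternatingMap.ofSubsingletonLIE (𝕜 := ℝ) (E := V) (F := ℝ) (0 : Fin 1)
        (-((ContinuousLinearMap.compL ℝ V V ℝ).flip (iSMulCLM V) (fderiv ℝ f x))) := by
  funext x
  rfl

/-- Differentiability of `d^c f` at a point where `Df` is differentiable. [folklore] -/
theorem differentiableAt_dcForm {f : V → ℝ} {x : V} (hf : DifferentiableAt ℝ (fderiv ℝ f) x) :
    DifferentiableAt ℝ (dcForm f) x := by
  rw [dcForm_eq_comp]
  exact (ContinuousAlternatingMap.ofSubsingletonLIE (𝕜 := ℝ) (E := V) (F := ℝ)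
    (0 : Fin 1)).toContinuousLinearEquiv.toContinuousLinearMap.differentiableAt.comp x
      ((((ContinuousLinearMap.compL ℝ V V ℝ).flip (iSMulCLM V)).differentiableAt.comp x hf).neg)

/-- Smoothness of `d^c f`: if `f` is `C^n` and `m + 1 ≤ n` then `d^c f` is `C^m`. [folklore] -/
theorem contDiff_dcForm {f : V → ℝ} {n m : WithTop ℕ∞} (hf : ContDiff ℝ n f) (hmn : m + 1 ≤ n) :
    ContDiff ℝ m (dcForm f) := by
  rw [dcForm_eq_comp]
  exact (ContinuousAlternatingMap.ofSubsingletonLIE (𝕜 := ℝ) (E := V) (F := ℝ)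
    (0 : Fin 1)).toContinuousLinearEquiv.toContinuousLinearMap.contDiff.comp
      ((((ContinuousLinearMap.compL ℝ V V ℝ).flip (iSMulCLM V)).contDiff.comp
        (hf.fderiv_right hmn)).neg)

/-- `d^c f` vanishes where `Df` vanishes on a neighbourhood (e.g. where `f` is locally constant).
[folklore] -/
theorem dcForm_eq_zero_of_fderiv_eq_zero {f : V → ℝ} {x : V} (hf : fderiv ℝ f x = 0) :
    dcForm f x = 0 := by
  ext v
  simp [hf]

/-! ### `dd^c f` -/

/-- **The real `2`-form `dd^c f = d(d^c f)`** (Mathlib's exterior derivative `extDeriv` of the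
`1`-form field `d^c f`; `= 2i ∂∂̄ f`). [cite: Chirka1989, §13.2] -/
def ddcForm (f : V → ℝ) : V → V [⋀^Fin 2]→L[ℝ] ℝ := extDeriv (dcForm f)

/-- Unfolding: `dd^c f = extDeriv (d^c f)`. [folklore] -/
theorem ddcForm_def (f : V → ℝ) : ddcForm f = extDeriv (dcForm f) := rfl

/-- **`(dd^c f)(x)(a, b) = D²f(x)(b)(i a) - D²f(x)(a)(i b)`** at a point where `Df` is
differentiable (`D²f = fderiv (fderiv f)`). [cite: Chirka1989, §13.2] -/
theorem ddcForm_apply {f : V → ℝ} {x : V} (hf : DifferentiableAt ℝ (fderiv ℝ f) x)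
    (v : Fin 2 → V) :
    ddcForm f x v =
      fderiv ℝ (fderiv ℝ f) x (v 1) (Complex.I • v 0) - fderiv ℝ (fderiv ℝ f) x (v 0) (Complex.I • v 1) := by
  rw [ddcForm_def, extDeriv_apply (differentiableAt_dcForm hf)]
  -- the two terms `i = 0, 1`
  have key : ∀ (a b : V), fderiv ℝ (fun y => dcForm f y ![b]) x a =
      -(fderiv ℝ (fderiv ℝ f) x a (Complex.I • b)) := by
    intro a b
    have h1 : (fun y => dcForm f y ![b]) = fun y => -((fderiv ℝ f y) (Complex.I • b)) := by
      funext y; simp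
    have h2 : fderiv ℝ (fun y => (fderiv ℝ f y) (Complex.I • b)) x a =
        fderiv ℝ (fderiv ℝ f) x a (Complex.I • b) := by
      rw [fderiv_clm_apply hf (differentiableAt_const _)]
      simp
    rw [h1, fderiv_fun_neg, ← h2]
    rfl
  rw [Fin.sum_univ_two]
  have h0 : (Fin.removeNth (0 : Fin 2) v) = ![v 1] := by
    ext i; fin_cases i; rfl
  have h1' : (Fin.removeNth (1 : Fin 2) v) = ![v 0] := by
    ext i; fin_cases i; rfl
  simp only [h0, h1', key, Fin.val_zero, pow_zero, one_smul, Fin.val_one, pow_one, neg_smul,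
    one_smul]
  ring

/-- **The Levi form**: `(dd^c f)(x)(a, i a) = D²f(x)(a)(a) + D²f(x)(i a)(i a)`. For a `C²`
function this is `≥ 0` for all `a` iff `f` is plurisubharmonic [HormanderSCV1973, Thm. 2.6.2];
cf. `Literature.Analysis.Pluripotential.levi_nonneg_of_frequently_le_circleAverage`.
[cite: HormanderSCV1973, Thm. 2.6.2] -/
theorem ddcForm_apply_self_I_smul {f : V → ℝ} {x : V} (hf : DifferentiableAt ℝ (fderiv ℝ f) x)
    (a : V) :
    ddcForm f x ![a, Complex.I • a] =
      fderiv ℝ (fderiv ℝ f) x a a + fderiv ℝ (fderiv ℝ f) x (Complex.I • a) (Complex.I • a) := by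
  rw [ddcForm_apply hf]
  simp only [Matrix.cons_val_one, Matrix.cons_val_zero, smul_smul, Complex.I_mul_I, neg_smul,
    one_smul, map_neg]
  ring


/-- **`dd^c f` is a `(1,1)`-form**: it is invariant under the complex structure,
`(dd^c f)(x)(i a, i b) = (dd^c f)(x)(a, b)`, whenever the second derivative is symmetric (e.g. `f`
of class `C²` at `x`, Mathlib's `ContDiffAt.isSymmSndFDerivAt`). [cite: Chirka1989, §13.2] -/
theorem ddcForm_apply_I_smul_I_smul {f : V → ℝ} {x : V} (hf : DifferentiableAt ℝ (fderiv ℝ f) x)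
    (hsym : ∀ a b : V, fderiv ℝ (fderiv ℝ f) x a b = fderiv ℝ (fderiv ℝ f) x b a) (a b : V) :
    ddcForm f x ![Complex.I • a, Complex.I • b] = ddcForm f x ![a, b] := by
  rw [ddcForm_apply hf, ddcForm_apply hf]
  simp only [Matrix.cons_val_one, Matrix.cons_val_zero, smul_smul, Complex.I_mul_I, neg_smul,
    one_smul, map_neg]
  rw [hsym (Complex.I • b) a, hsym (Complex.I • a) b]
  ring

/-- **`dd^c f` through the Levi form**: with `L(a, b) = ½ (D²f(x)(a)(b) + D²f(x)(i a)(i b))` the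
`J`-invariant part of the (symmetric) Hessian, `(dd^c f)(x)(a, b) = 2 L(b, i a)`; in particular
`(dd^c f)(x)(a, i a) = 2 L(a, a)` (`ddcForm_apply_self_I_smul`). [cite: Chirka1989, §13.2] -/
theorem ddcForm_apply_eq_hessian_add_hessian {f : V → ℝ} {x : V}
    (hf : DifferentiableAt ℝ (fderiv ℝ f) x)
    (hsym : ∀ a b : V, fderiv ℝ (fderiv ℝ f) x a b = fderiv ℝ (fderiv ℝ f) x b a) (a b : V) :
    ddcForm f x ![a, b] =
      fderiv ℝ (fderiv ℝ f) x b (Complex.I • a) +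
        fderiv ℝ (fderiv ℝ f) x (Complex.I • b) (Complex.I • (Complex.I • a)) := by
  rw [ddcForm_apply hf]
  simp only [Matrix.cons_val_one, Matrix.cons_val_zero, smul_smul, Complex.I_mul_I, neg_smul,
    one_smul, map_neg]
  rw [hsym (Complex.I • b) a]
  ring

/-- `dd^c f` is alternating: `(dd^c f)(x)(a, a) = 0`. [folklore] -/
theorem ddcForm_apply_self (f : V → ℝ) (x : V) (a : V) : ddcForm f x ![a, a] = 0 :=
  (ddcForm f x).map_eq_zero_of_eq ![a, a] (by simp) (show (0 : Fin 2) ≠ 1 by decide)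

/-- Smoothness of `dd^c f`: if `f` is `C^n` and `m + 2 ≤ n` then `dd^c f` is `C^m`. [folklore] -/
theorem contDiff_ddcForm {f : V → ℝ} {n m : WithTop ℕ∞} (hf : ContDiff ℝ n f) (hmn : m + 2 ≤ n) :
    ContDiff ℝ m (ddcForm f) := by
  rw [ddcForm_def]
  have h1 : ContDiff ℝ (m + 1) (dcForm f) :=
    contDiff_dcForm hf (by simpa [add_assoc, one_add_one_eq_two] using hmn)
  -- `extDeriv ω = alternatizeUncurryFin ∘ fderiv ω`
  unfold extDeriv
  exact (ContinuousAlternatingMap.alternatizeUncurryFinCLM ℝ V ℝ).contDiff.comp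
    (h1.fderiv_right le_rfl)

/-- **`d(dd^c f) = 0`** for `C³` functions (`d ∘ d = 0`, Mathlib's `extDeriv_extDeriv`).
[folklore] -/
theorem extDeriv_ddcForm {f : V → ℝ} (hf : ContDiff ℝ 3 f) : extDeriv (ddcForm f) = 0 := by
  rw [ddcForm_def]
  have h1 : ContDiff ℝ 2 (dcForm f) := contDiff_dcForm hf (by norm_num)
  exact extDeriv_extDeriv h1 (by simp)

/-- `dd^c f` vanishes on an open set where `f` is constant. [folklore] -/
theorem ddcForm_eq_zero_of_eventuallyEq_const {f : V → ℝ} {x : V} {c : ℝ}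
    (hf : f =ᶠ[𝓝 x] fun _ => c) : ddcForm f x = 0 := by
  -- near `x`, `d^c f = 0`, so its exterior derivative vanishes at `x`
  have h0 : dcForm f =ᶠ[𝓝 x] fun _ => (0 : V [⋀^Fin 1]→L[ℝ] ℝ) := by
    have h1 : ∀ᶠ y in 𝓝 x, f =ᶠ[𝓝 y] fun _ => c := hf.eventually_nhds
    filter_upwards [h1] with y hy
    apply dcForm_eq_zero_of_fderiv_eq_zero
    rw [hy.fderiv_eq]
    exact fderiv_const_apply c
  rw [ddcForm_def, h0.extDeriv_eq]
  ext v
  rw [extDeriv_apply (differentiableAt_const _)]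
  simp

end Literature.Geometry.Kaehler

end
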